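import Summits.KontsevichZagierPeriods.KontsevichZagierPeriods.Theses.AttractorUnfolding
import Summits.KontsevichZagierPeriods.KontsevichZagierPeriods.Theorems.TerasomaMultiplicationBetaCancellationOfAyoubPiCancellation

/-!
# Crux `ResidueKernel` (stmt-KontsevichZagierPeriods-11360) — birth skeleton (`Lines/birth.lean`, BC3)

Route `AttractorUnfolding`, rank-0 TARGET crux `ResidueKernel` (auto-crux: conjecture-grade): the kernel
conjecture of the Kontsevich–Zagier calculus ENLARGED by the route's fibrewise-Cauchy (E1) and
fibrewise-residue (E2) relators,
`∀ d, KZ.eval d = 0 → d ∈ KZ.relations ⊔ closure (E1-relators ∪ E2-relators)`.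
Honest status (route docstring): modulo the engine `FibrewiseCauchy ∧ FibrewiseResidue` it is the kernel
form of Conjecture 1, i.e. summit-strength; it is REACHED (route-choice repair 2026-08-16) through the
π-LOCALISATION PAIR shared with route AyoubSpecialisation — "the Tate twist `[π]⋆` is a tube".

This file is that decomposition as a REGISTERED SKELETON (BC2 redirect one level down, BC3 shape):

* `stub_twistCancellation` = route item `TwistCancellation` BY NAME (item stmt-KontsevichZagierPeriods-0540,
  shared: `AyoubSpecialisation.AyoubPiCancellation`, `KatzTower.PiCancellation`, …; closed form
  `Literature.NumberTheory.Transcendental.KZ.PiCancellation`, landed dictionary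
  `BetaCancellationLine.stub_ayoubBridge`): for the pinned product `P n r = [unit disc] × r`,
  `lift (of ∘ P) c ∈ KZ.relations → c ∈ KZ.relations` — `[π]` is a non-zero-divisor modulo the moves.
  Conjecture-grade, transcendence-free (open in print: HuberWustholz2022 App. A.4, Ayoub2015 Rem. 1.3).
* `stub_twistLocalKernel` = route item `TwistLocalKernel` BY NAME (item stmt-KontsevichZagierPeriods-0541,
  shared: `AyoubSpecialisation.AyoubPiLocalKernel`, …; closed form `KZ.PiLocalKernel`, Ayoub2014 Conj. 7):
  `KZ.eval c = 0 → ∃ N, (lift (of ∘ P))^[N] c ∈ KZ.relations` — Conjecture 1 for the period ring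
  localised at `[π]`, the form every torsor argument in print addresses. Conjecture-grade (GPC-strength
  once the first stub holds). HARDEST stub.
* The pinned product EXISTS — route support item `TwistProductRep` (stmt-KontsevichZagierPeriods-10941) is
  the landed theorem `BetaCancellationLine.exists_pinned` (Theorems/TerasomaMultiplicationBetaCancellation
  OfAyoubPiCancellation.lean: `P n r := ([π] × r).reindex (Fin (2 + n) ≃ Fin (n + 2))`), cited here by
  name (`twistProductRep_holds`), so it is NOT a stub.

Composition `ResidueKernel_of : TwistCancellation → TwistLocalKernel → ResidueKernel` (arrow form, real
proof, no `sorry`; = the route's glue item `ResidueKernelGlue` with its first hypothesis discharged): for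
`d` with `eval d = 0` take `N` from the local kernel and peel one `[π]` at a time with cancellation
(left-nested iterates, `Function.iterate_succ_apply'`, induction on `N`), giving `d ∈ KZ.relations`,
hence `d ∈ KZ.relations ⊔ closure (…)` by `AddSubgroup.mem_sup_left`. `ResidueKernel_skeleton :
ResidueKernel` plugs the two stubs in BY NAME (its only `sorry`s are the two stubs').

Why no stub is the crux or the summit in disguise (BC3 probes, registrar folder `bc/probe_*.lean`, all
FAIL — see NOTES.md of the registrar for rc and goals): `stub_twistCancellation` constrains no value
(it is implied by, and strictly weaker-looking than, Conjecture 1: `KZ.piCancellation_of_kernel`), and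
`stub_twistLocalKernel` reaches `KZ.relations` only up to a power of `[π]`; TOGETHER they are exactly the
kernel form (landed: `AyoubSpecialisation.kontsevichZagierPeriods_iff_piLocalKernel_and_piCancellation`,
`LiouvilleUnfolding.PiLocalKernelPosition.summit_iff_ayoubPiLocalKernel_and_ayoubPiCancellation`) — the
split is Kontsevich–Zagier's passage `P̂ = P[(2πi)⁻¹]` (Periods 2001 §4.1) read in both directions, and
each half has its own crux directory, Disproof file, registered skeleton and live line
(Cruxes/AyoubPiCancellation, Cruxes/AyoubPiLocalKernel).

Disproof used (the stubs are the shared items VERBATIM, so every load-bearing clause is kept):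
`AyoubPiCancellationNegative.ayoubPiCancellation_false_without_pinning` / `_false_without_domainClause` /
`_false_without_integrandClause` / `_false_at_radius_zero` (Theorems/AyoubPiCancellation/Negative/
LoadBearing.lean) — honoured: `stub_twistCancellation` keeps the full pinning (unit disc, radius 1,
domain AND integrand clauses); `AyoubPiLocalKernelNegative.ayoubPiLocalKernel_false_without_evalZero`,
`withoutPinning_iff_summit`, `exponentZero_iff_kzKernelConjecture` (Theorems/AyoubPiLocalKernel/Negative/
LoadBearing.lean) — honoured: `stub_twistLocalKernel` keeps `eval c = 0`, the pinning and the free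
exponent `∃ N`. No Disproof.lean is on record for `ResidueKernel` itself (`ledger crux ls`: empty dir);
negatives index of the summit: KinematicPlaneConvex (stmt-5394) only, unrelated.
-/

noncomputable section

-- `Summit.KontsevichZagierPeriods.KontsevichZagierPeriods.…` is the tree's mandated layout (single-conjunct summit).
set_option linter.dupNamespace false

namespace Summit.KontsevichZagierPeriods.KontsevichZagierPeriods.Cruxes.ResidueKernel.Birth

open Summit.KontsevichZagierPeriods.KontsevichZagierPeriods.Theses.AttractorUnfolding

/-! ### Registered stubs -/

/-- **STUB (conjecture-grade) — twist cancellation = route item `TwistCancellation` by name**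
(item stmt-KontsevichZagierPeriods-0540, shared with AyoubSpecialisation `AyoubPiCancellation`; closed
form `KZ.PiCancellation`): for every pinned product `P` (`P n r = [unit disc] × r`) and every formal
combination `c`, `lift (of ∘ P) c ∈ KZ.relations → c ∈ KZ.relations`. Why it might fail: a certificate
for `[π] ⋆ c` may mix the two disc coordinates with `c`'s own by changes of variables, leaving no shadow
certificate for `c`; the motivic analogue (effective → `2πi`-localised formal periods injective) is open
in print. [HuberWustholz2022 App. A.4; Ayoub2015 Rem. 1.3; KontsevichZagier2001 §4.1] -/
theorem stub_twistCancellation : TwistCancellation := by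
  sorry

/-- **STUB (conjecture-grade, the hardest) — twist-local kernel = route item `TwistLocalKernel` by
name** (item stmt-KontsevichZagierPeriods-0541, shared with AyoubSpecialisation `AyoubPiLocalKernel`;
closed form `KZ.PiLocalKernel`, Ayoub2014 Conj. 7): for every pinned product `P` and every `c` with
`KZ.eval c = 0` there is `N` with `(lift (of ∘ P))^[N] c ∈ KZ.relations` — Conjecture 1 for the period
ring localised at `[π]`; on this route: every vanishing combination is derivable after finitely many
tubings (contour presentations where the residue theorem with parameters is a derived rule, E1/E2).
Why it might fail: period-conjecture strength once `stub_twistCancellation` holds; torsor methods give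
relations in Nori's presentation only and their transfer into the four moves is unproved.
[Ayoub2014 Conj. 7; HuberMullerStachPeriods2017 Conj. 13.2.1; KontsevichZagier2001 §4.1] -/
theorem stub_twistLocalKernel : TwistLocalKernel := by
  sorry

/-! ### The pinned product exists (route support item `TwistProductRep`, a LANDED theorem — not a stub) -/

/-- Route item `TwistProductRep` (stmt-KontsevichZagierPeriods-10941) is, verbatim, the landed theorem
`BetaCancellationLine.exists_pinned`: `P n r := ([π] × r).reindex (finCongr (2 + n = n + 2))`.
[cite: KontsevichZagier2001, §4.1] -/
theorem twistProductRep_holds : TwistProductRep :=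
  Summit.KontsevichZagierPeriods.KontsevichZagierPeriods.BetaCancellationLine.exists_pinned

/-! ### Composition (no `sorry` below this line except through the two stubs, by name) -/

/-- **Composition, arrow form** (the BC3 skeleton theorem: `<stub₁-sig> → <stub₂-sig> → ResidueKernel`,
real proof): twist cancellation and the twist-local kernel give the plain kernel form
`ker eval ≤ KZ.relations` (peel one `[π]` at a time: induction on the exponent, iterates left-nested),
and `KZ.relations ≤ KZ.relations ⊔ closure (E1 ∪ E2)`. The pinned product is supplied by the landed
`twistProductRep_holds`. [cite: KontsevichZagier2001, §4.1] [cite: Ayoub2014, Def. 6 and Conj. 7] -/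
theorem ResidueKernel_of :
    TwistCancellation → TwistLocalKernel →
      Summit.KontsevichZagierPeriods.KontsevichZagierPeriods.Theses.AttractorUnfolding.ResidueKernel := by
  intro hcancel hloc d hd
  obtain ⟨P, hP⟩ := twistProductRep_holds
  refine AddSubgroup.mem_sup_left ?_
  obtain ⟨N, hN⟩ := hloc P hP d hd
  induction N with
  | zero => simpa using hN
  | succ N ih =>
    exact ih (hcancel P hP _ (by simpa only [Function.iterate_succ_apply'] using hN))

/-- **The crux from the two registered stubs, BY NAME** (its only `sorry`s are inside
`stub_twistCancellation`, `stub_twistLocalKernel`; once items 0540 / 0541 land in their own signatures,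
replacing the two stubs by those theorems closes stmt-KontsevichZagierPeriods-11360 with this term).
[cite: KontsevichZagier2001, §4.1] -/
theorem ResidueKernel_skeleton :
    Summit.KontsevichZagierPeriods.KontsevichZagierPeriods.Theses.AttractorUnfolding.ResidueKernel :=
  ResidueKernel_of stub_twistCancellation stub_twistLocalKernel

end Summit.KontsevichZagierPeriods.KontsevichZagierPeriods.Cruxes.ResidueKernel.Birth

end
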